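import Summits.QuantumFields.YangMills.Theorems.AllWindowsColdBoxBulkMidSandwichLocalisedHessian

/-!
# The Hessian-explicit affine-dual inequality, the localised Cramér–Rao floor and the localised
# score-defect second moment
# (crux idea `logconcave-core-extension` on ⟨stmt-QuantumFields-24006⟩ — toward a LOCALISED quadratic
# covariance comparison at the core constant `r_K`)

Whitened frame, `A ∈ C²(ℝⁿ)` with the global second-difference sandwich `(1 ± δ)|h|²` (`0 ≤ δ < 1`), a
measurable core `K` with Hessian pinching `(1 ± δ_K)|v|²`, centring `∫ x_i e^{−A} = 0`; `Z = ∫e^{−A}`,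
`P = ∫_{Kᶜ}e^{−A}`.

* `affine_dual_ineq_hess` : for an affine field `u = Mx + m`, a `C¹` observable `F` of cubic growth and a
  constant `c`: `2∫∂_uF e^{−A} − tr(M²)Z − ∫ D²A(u,u) e^{−A} ≤ ∫(F − c)²e^{−A}` — the tree's
  `affine_dual_ineq` BEFORE the Hessian term is bounded by the sandwich (expand `0 ≤ ∫(F − c − G_u)²e^{−A}`
  with the score identities and `integral_score_sq`);
* `integral_sq_dotProduct_ge_localised` : **localised Cramér–Rao** `|w|²((1−δ_K)Z − (δ−δ_K)P) ≤ ∫(w·x)²e^{−A}`;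
* `phi_sq_le_localised` : **localised score-defect second moment**
  `∫(∂_vA − v·x)²e^{−A} ≤ |v|²((1−δ_K)⁻¹δ_K²(Z − P) + (1−δ)⁻¹δ²P)` (localised Brascamp–Lieb applied to the
  mean-zero `φ = ∂_vA − v·x`, whose gradient is the pointwise defect `D²A − 1` read at the local constant).

HONEST SCOPE.  Free-hands work of the LEAD seat of ⟨stmt-QuantumFields-24006⟩ (FCL lineage) on an ingredient
of an UN-TRIAGED crux idea card; classical log-concave probability.  No stub of LINE-18, no crux, rung or
summit is proved; the Yang–Mills mass gap is NOT proved by any of this.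
-/

noncomputable section

namespace Summit.QuantumFields.YangMills.Theorems.SandwichVariancePinching

open MeasureTheory Real Filter Topology Set
open Literature.Probability.Distributions (coordGradient coordHessian bl_wholeSpace_raw continuous_blQuad)
open Summit.QuantumFields.YangMills.Cruxes.TransportCovarianceTransfer (contDiff_quadObs fderiv_quadObs)

variable {n : ℕ}

/-! ## §1 The affine-dual inequality with the Hessian term explicit -/

/-- **THE AFFINE-DUAL VARIANCE INEQUALITY, HESSIAN-EXPLICIT FORM.** For a `C²` potential with the whitened
sandwich, an affine field `u(x) = Mx + m`, a `C¹` observable `F` of cubic growth and any constant `c`: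
`2∫ ∂_uF e^{−A} − tr(M²)∫e^{−A} − ∫ D²A(u,u) e^{−A} ≤ ∫ (F − c)² e^{−A}`
(expand `0 ≤ ∫ (F − c − G_u)² e^{−A}` with the score identities). [folklore] -/
theorem affine_dual_ineq_hess {A : (Fin n → ℝ) → ℝ} (hA : ContDiff ℝ 2 A) {δ : ℝ}
    (hδ : 0 ≤ δ) (hδ1 : δ < 1)
    (hsw : ∀ x h : Fin n → ℝ, (1 - δ) * (h ⬝ᵥ h) ≤ A (x + h) + A (x - h) - 2 * A x ∧
      A (x + h) + A (x - h) - 2 * A x ≤ (1 + δ) * (h ⬝ᵥ h))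
    (M : Matrix (Fin n) (Fin n) ℝ) (m : Fin n → ℝ) {F : (Fin n → ℝ) → ℝ} (hF : ContDiff ℝ 1 F)
    {DF DF' : ℝ} (hFb : ∀ x, |F x| ≤ DF * (1 + ‖x‖) ^ 3)
    (hF'b : ∀ x (j : Fin n), |fderiv ℝ F x (Pi.single j 1)| ≤ DF' * (1 + ‖x‖) ^ 2) (c : ℝ) :
    2 * (∫ x, fderiv ℝ F x (M.mulVec x + m) * exp (-A x)) - (M * M).trace * (∫ x, exp (-A x))
      - (∫ x, fderiv ℝ (fderiv ℝ A) x (M.mulVec x + m) (M.mulVec x + m) * exp (-A x))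
      ≤ ∫ x, (F x - c) ^ 2 * exp (-A x) := by
  have hAc : Continuous A := hA.continuous
  obtain ⟨C₀, κ, _, hκ, hlb⟩ := exists_quadratic_lower_of_sandwich hAc hδ1 hsw
  set G : (Fin n → ℝ) → ℝ := fun x => fderiv ℝ A x (M.mulVec x + m) - M.trace with hGdef
  have hGc : ContDiff ℝ 1 G := (contDiff_fderiv_affine hA M m).sub contDiff_const
  obtain ⟨D₁, hD₁0, hD₁⟩ := exists_abs_fderiv_affine_le hA hδ hsw M m
  have hGb : ∀ x, |G x| ≤ (D₁ + |M.trace|) * (1 + ‖x‖) ^ 3 := fun x => by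
    have h1 := hD₁ x
    have h2 : (1:ℝ) ≤ (1 + ‖x‖) ^ 3 := one_le_pow₀ (by linarith [norm_nonneg x])
    calc |G x| ≤ |fderiv ℝ A x (M.mulVec x + m)| + |M.trace| := abs_sub _ _
      _ ≤ D₁ * (1 + ‖x‖) ^ 3 + |M.trace| * (1 + ‖x‖) ^ 3 :=
          add_le_add h1 (le_mul_of_one_le_right (abs_nonneg _) h2)
      _ = (D₁ + |M.trace|) * (1 + ‖x‖) ^ 3 := by ring
  -- the shifted observable `F − c`
  have hFc : ContDiff ℝ 1 (fun x => F x - c) := hF.sub contDiff_const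
  have hFcb : ∀ x, |F x - c| ≤ (DF + |c|) * (1 + ‖x‖) ^ 3 := fun x => by
    have h2 : (1:ℝ) ≤ (1 + ‖x‖) ^ 3 := one_le_pow₀ (by linarith [norm_nonneg x])
    calc |F x - c| ≤ |F x| + |c| := abs_sub _ _
      _ ≤ DF * (1 + ‖x‖) ^ 3 + |c| * (1 + ‖x‖) ^ 3 :=
          add_le_add (hFb x) (le_mul_of_one_le_right (abs_nonneg _) h2)
      _ = (DF + |c|) * (1 + ‖x‖) ^ 3 := by ring
  have hFcd : ∀ x, fderiv ℝ (fun y => F y - c) x = fderiv ℝ F x := fun x => fderiv_sub_const c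
  have hFc'b : ∀ x (j : Fin n), |fderiv ℝ (fun y => F y - c) x (Pi.single j 1)| ≤ DF' * (1 + ‖x‖) ^ 2 :=
    fun x j => by rw [hFcd]; exact hF'b x j
  -- integrability
  have hI1 : Integrable fun x => (F x - c) ^ 2 * exp (-A x) := by
    have := abs_mul_le_growth hFcb hFcb
    refine integrable_mul_exp_neg_of_growth hAc ((hFc.continuous).pow 2) hκ (by norm_num : 3 + 3 ≤ 8)
      hlb (D := (DF + |c|) * (DF + |c|)) (fun x => ?_)
    rw [sq]; exact this x
  have hI2 : Integrable fun x => (F x - c) * G x * exp (-A x) :=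
    integrable_mul_exp_neg_of_growth hAc (hFc.continuous.mul hGc.continuous) hκ
      (by norm_num : 3 + 3 ≤ 8) hlb (abs_mul_le_growth hFcb hGb)
  have hI3 : Integrable fun x => G x ^ 2 * exp (-A x) := by
    have := abs_mul_le_growth hGb hGb
    refine integrable_mul_exp_neg_of_growth hAc ((hGc.continuous).pow 2) hκ (by norm_num : 3 + 3 ≤ 8)
      hlb (D := (D₁ + |M.trace|) * (D₁ + |M.trace|)) (fun x => ?_)
    rw [sq]; exact this x
  have hI2dA : Integrable fun x => (F x - c) * fderiv ℝ A x (M.mulVec x + m) * exp (-A x) :=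
    integrable_mul_exp_neg_of_growth hAc (hFc.continuous.mul (contDiff_fderiv_affine hA M m).continuous)
      hκ (by norm_num : 3 + 3 ≤ 8) hlb (abs_mul_le_growth hFcb hD₁)
  have hIFc : Integrable fun x => (F x - c) * exp (-A x) :=
    integrable_mul_exp_neg_of_growth hAc hFc.continuous hκ (by norm_num) hlb hFcb
  have hIdF : Integrable fun x => fderiv ℝ F x (M.mulVec x + m) * exp (-A x) := by
    have hc := fun j : Fin n => exists_abs_affine_apply_le M m j
    choose Cj hCj0 hCj using hc
    have hCc : ∀ x, |fderiv ℝ F x (M.mulVec x + m)| ≤ (∑ j, Cj j * DF') * (1 + ‖x‖) ^ 3 := by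
      intro x
      rw [clm_apply_eq_sum_single, Finset.sum_mul]
      refine (Finset.abs_sum_le_sum_abs _ _).trans (Finset.sum_le_sum fun j _ => ?_)
      rw [abs_mul]
      calc |(M.mulVec x + m) j| * |fderiv ℝ F x (Pi.single j 1)|
          ≤ (Cj j * (1 + ‖x‖)) * (DF' * (1 + ‖x‖) ^ 2) :=
            mul_le_mul (hCj j x) (hF'b x j) (abs_nonneg _) (mul_nonneg (hCj0 j) (by positivity))
        _ = Cj j * DF' * (1 + ‖x‖) ^ 3 := by ring
    exact integrable_mul_exp_neg_of_growth hAc ((hF.continuous_fderiv one_ne_zero).clm_apply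
      (contDiff_affine M m).continuous) hκ (by norm_num) hlb hCc
  -- (I1) for `F − c`
  have hI1id := integral_mul_fderiv_affine_mul_exp_neg hA hδ hδ1 hsw M m hFc hFcb hFc'b
  simp only [hFcd] at hI1id
  have hcross : ∫ x, (F x - c) * G x * exp (-A x) = ∫ x, fderiv ℝ F x (M.mulVec x + m) * exp (-A x) := by
    have e1 : (fun x => (F x - c) * G x * exp (-A x)) = fun x =>
        (F x - c) * fderiv ℝ A x (M.mulVec x + m) * exp (-A x) - M.trace * ((F x - c) * exp (-A x)) := by
      funext x; simp only [hGdef]; ring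
    have e2 : (fun x => (fderiv ℝ F x (M.mulVec x + m) + M.trace * (F x - c)) * exp (-A x)) =
        fun x => fderiv ℝ F x (M.mulVec x + m) * exp (-A x) + M.trace * ((F x - c) * exp (-A x)) := by
      funext x; ring
    rw [e1, integral_sub hI2dA (hIFc.const_mul _), hI1id, e2,
      integral_add hIdF (hIFc.const_mul _), integral_const_mul]
    ring
  -- `∫ G² e^{−A} = tr(M²) Z + ∫ D²A(u,u) e^{−A}` (exact)
  have hG2 := integral_score_sq hA hδ hδ1 hsw M m
  have hG2eq : ∫ x, G x ^ 2 * exp (-A x) = (M * M).trace * (∫ x, exp (-A x)) +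
      ∫ x, fderiv ℝ (fderiv ℝ A) x (M.mulVec x + m) (M.mulVec x + m) * exp (-A x) := by
    rw [show (fun x => G x ^ 2 * exp (-A x)) =
        fun x => (fderiv ℝ A x (M.mulVec x + m) - M.trace) ^ 2 * exp (-A x) from rfl, hG2]
  -- expand the square
  have hnn : 0 ≤ ∫ x, (F x - c - G x) ^ 2 * exp (-A x) :=
    integral_nonneg fun x => mul_nonneg (sq_nonneg _) (exp_pos _).le
  have hexp : (fun x => (F x - c - G x) ^ 2 * exp (-A x)) = fun x =>
      (F x - c) ^ 2 * exp (-A x) - 2 * ((F x - c) * G x * exp (-A x)) + G x ^ 2 * exp (-A x) := by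
    funext x; ring
  have hI12 : Integrable fun x => (F x - c) ^ 2 * exp (-A x) - 2 * ((F x - c) * G x * exp (-A x)) :=
    hI1.sub (hI2.const_mul 2)
  rw [hexp, integral_add hI12 hI3, integral_sub hI1 (hI2.const_mul 2), integral_const_mul, hcross, hG2eq] at hnn
  linarith

/-! ## §2 The localised Cramér–Rao floor -/

/-- **LOCALISED CRAMÉR–RAO FLOOR**: `|w|²·((1−δ_K)Z − (δ−δ_K)P) ≤ ∫ (w·x)² e^{−A}` (`P = ∫_{Kᶜ}e^{−A}`)
— the Hessian-explicit affine-dual inequality with the linear observable `w·x`, the constant field `w`,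
`c = 0`, the centring, and the localised Hessian integral. [folklore] -/
theorem integral_sq_dotProduct_ge_localised {A : (Fin n → ℝ) → ℝ} (hA : ContDiff ℝ 2 A) {δ : ℝ}
    (hδ : 0 ≤ δ) (hδ1 : δ < 1)
    (hsw : ∀ x h : Fin n → ℝ, (1 - δ) * (h ⬝ᵥ h) ≤ A (x + h) + A (x - h) - 2 * A x ∧
      A (x + h) + A (x - h) - 2 * A x ≤ (1 + δ) * (h ⬝ᵥ h))
    {K : Set (Fin n → ℝ)} (hK : MeasurableSet K) {δK : ℝ}
    (hloc : ∀ x ∈ K, ∀ v : Fin n → ℝ, fderiv ℝ (fderiv ℝ A) x v v ≤ (1 + δK) * (v ⬝ᵥ v))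
    (w : Fin n → ℝ) :
    (w ⬝ᵥ w) * ((1 - δK) * (∫ x, exp (-A x)) - (δ - δK) * ∫ x in Kᶜ, exp (-A x)) ≤
      ∫ x, (w ⬝ᵥ x) ^ 2 * exp (-A x) := by
  have hAc : Continuous A := hA.continuous
  obtain ⟨C₀, κ, _, hκ, hlb⟩ := exists_quadratic_lower_of_sandwich hAc hδ1 hsw
  have hZint : Integrable fun x => exp (-A x) := by
    have := integrable_mul_exp_neg_of_growth hAc continuous_const hκ (by norm_num : 0 ≤ 8) hlb
      (w := fun _ => (1:ℝ)) (D := 1) (fun x => by simp)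
    simpa using this
  -- the linear observable as a (degenerate) quadratic observable
  set F : (Fin n → ℝ) → ℝ := fun y => y ⬝ᵥ (0 : Matrix (Fin n) (Fin n) ℝ).mulVec y + w ⬝ᵥ y with hFdef
  have hFw : ∀ y, F y = w ⬝ᵥ y := fun y => by simp [hFdef]
  have hFc : ContDiff ℝ 1 F := contDiff_quadObs 0 w
  have hFd : ∀ x v, fderiv ℝ F x v = w ⬝ᵥ v := fun x v => by
    rw [hFdef, fderiv_quadObs (Matrix.isSymm_zero) w x v]; simp
  have hFb : ∀ x, |F x| ≤ (∑ j, |w j|) * (1 + ‖x‖) ^ 3 := fun x => by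
    rw [hFw]; exact growth_mono (by norm_num) (abs_dotProduct_le_growth w) x
  have hF'b : ∀ x (j : Fin n), |fderiv ℝ F x (Pi.single j 1)| ≤ (∑ i, |w i|) * (1 + ‖x‖) ^ 2 := by
    intro x j
    rw [hFd, dotProduct_single, mul_one]
    have h2 : (1:ℝ) ≤ (1 + ‖x‖) ^ 2 := by nlinarith [norm_nonneg x]
    exact (Finset.single_le_sum (fun i _ => abs_nonneg (w i)) (Finset.mem_univ j)).trans
      (le_mul_of_one_le_right (Finset.sum_nonneg fun i _ => abs_nonneg _) h2)
  -- Hessian-explicit affine dual with `M = 0`, `m = w`, `c = 0`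
  have key := affine_dual_ineq_hess hA hδ hδ1 hsw 0 w hFc hFb hF'b 0
  simp only [Matrix.zero_mulVec, zero_add, Matrix.trace_zero, zero_mul, sub_zero, hFd, hFw] at key
  -- the Hessian integral along the constant field `w`
  have hH := integral_hess_affine_le_localised hA hδ hδ1 hsw hK hloc 0 w
  simp only [Matrix.zero_mulVec, zero_add] at hH
  have e1 : ∫ x, (w ⬝ᵥ w) * exp (-A x) = (w ⬝ᵥ w) * ∫ x, exp (-A x) := integral_const_mul _ _
  have e2 : ∫ x in Kᶜ, (w ⬝ᵥ w) * exp (-A x) = (w ⬝ᵥ w) * ∫ x in Kᶜ, exp (-A x) := integral_const_mul _ _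
  rw [e1, e2] at hH
  rw [e1] at key
  nlinarith [key, hH]

/-! ## §3 The localised score-defect second moment -/

/-- **LOCALISED SCORE-DEFECT SECOND MOMENT**: for a centred sandwiched `C²` potential with the local Hessian
pinching `(1 ± δ_K)` on `K` (`δ_K < 1`),
`∫ (∂_vA − v·x)² e^{−A} ≤ |v|²·((1−δ_K)⁻¹δ_K²(Z − P) + (1−δ)⁻¹δ²P)`, `P = ∫_{Kᶜ}e^{−A}`. [folklore] -/
theorem phi_sq_le_localised {A : (Fin n → ℝ) → ℝ} (hA : ContDiff ℝ 2 A) {δ : ℝ} (hδ : 0 ≤ δ) (hδ1 : δ < 1)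
    (hsw : ∀ x h : Fin n → ℝ, (1 - δ) * (h ⬝ᵥ h) ≤ A (x + h) + A (x - h) - 2 * A x ∧
      A (x + h) + A (x - h) - 2 * A x ≤ (1 + δ) * (h ⬝ᵥ h))
    (hcent : ∀ i : Fin n, ∫ x, x i * exp (-A x) = 0)
    {K : Set (Fin n → ℝ)} (hK : MeasurableSet K) {δK : ℝ} (hδK1 : δK < 1)
    (hloc : ∀ x ∈ K, ∀ v : Fin n → ℝ, (1 - δK) * (v ⬝ᵥ v) ≤ fderiv ℝ (fderiv ℝ A) x v v ∧
      fderiv ℝ (fderiv ℝ A) x v v ≤ (1 + δK) * (v ⬝ᵥ v))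
    (v : Fin n → ℝ) :
    ∫ x, (fderiv ℝ A x v - v ⬝ᵥ x) ^ 2 * exp (-A x) ≤
      (v ⬝ᵥ v) * ((1 - δK)⁻¹ * δK ^ 2 * ((∫ x, exp (-A x)) - ∫ x in Kᶜ, exp (-A x)) +
        (1 - δ)⁻¹ * δ ^ 2 * ∫ x in Kᶜ, exp (-A x)) := by
  have hAc : Continuous A := hA.continuous
  obtain ⟨C₀, κ, _, hκ, hlb⟩ := exists_quadratic_lower_of_sandwich hAc hδ1 hsw
  have hZint : Integrable fun x => exp (-A x) := by
    have := integrable_mul_exp_neg_of_growth hAc continuous_const hκ (by norm_num : 0 ≤ 8) hlb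
      (w := fun _ => (1:ℝ)) (D := 1) (fun x => by simp)
    simpa using this
  have hZ : 0 < ∫ x, exp (-A x) := integral_exp_pos hZint
  set φ : (Fin n → ℝ) → ℝ := fun y => fderiv ℝ A y v - v ⬝ᵥ y with hφdef
  have hφc1 : ContDiff ℝ 1 φ := contDiff_phi hA v
  obtain ⟨Kv, hKv0, hKv⟩ := exists_abs_fderiv_le_of_sandwich hA hδ hsw v
  have hφb : ∀ x, |φ x| ≤ (Kv + ∑ i, |v i|) * (1 + ‖x‖) ^ 3 := fun x => by
    have h1 := hKv x
    have h2 := abs_dotProduct_le_growth v x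
    have hr : (1:ℝ) ≤ 1 + ‖x‖ := by linarith [norm_nonneg x]
    have hs : 0 ≤ ∑ i, |v i| := Finset.sum_nonneg fun i _ => abs_nonneg _
    calc |φ x| ≤ |fderiv ℝ A x v| + |v ⬝ᵥ x| := abs_sub _ _
      _ ≤ Kv * (1 + ‖x‖) ^ 2 + (∑ i, |v i|) * (1 + ‖x‖) ^ 1 := add_le_add h1 h2
      _ ≤ Kv * (1 + ‖x‖) ^ 3 + (∑ i, |v i|) * (1 + ‖x‖) ^ 3 := by
          nlinarith [pow_le_pow_right₀ hr (by norm_num : 2 ≤ 3), pow_le_pow_right₀ hr (by norm_num : 1 ≤ 3)]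
      _ = (Kv + ∑ i, |v i|) * (1 + ‖x‖) ^ 3 := by ring
  -- mean zero
  have hφ0 : ∫ x, φ x * exp (-A x) = 0 := by
    have h1 := integral_mul_fderiv_affine_mul_exp_neg hA hδ hδ1 hsw 0 v
      (F := fun _ => (1:ℝ)) contDiff_const (DF := 1) (DF' := 0)
      (fun x => by rw [abs_one, one_mul]; exact one_le_pow₀ (by linarith [norm_nonneg x]))
      (fun x j => by simp)
    simp only [one_mul, fderiv_fun_const, Pi.zero_apply, zero_apply, zero_add, Matrix.zero_mulVec,
      Matrix.trace_zero, zero_mul, mul_one] at h1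
    have hIa : Integrable fun x => fderiv ℝ A x v * exp (-A x) :=
      integrable_mul_exp_neg_of_growth hAc (continuous_fderiv_apply_of_contDiff hA _) hκ (by norm_num) hlb hKv
    have hIl : Integrable fun x => (v ⬝ᵥ x) * exp (-A x) :=
      integrable_mul_exp_neg_of_growth hAc (continuous_const.dotProduct continuous_id) hκ
        (by norm_num : 1 ≤ 8) hlb (abs_dotProduct_le_growth v)
    have e : (fun x => φ x * exp (-A x)) = fun x => fderiv ℝ A x v * exp (-A x) - (v ⬝ᵥ x) * exp (-A x) := by
      funext x; simp only [hφdef]; ring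
    rw [e, integral_sub hIa hIl, integral_dotProduct_mul_exp_neg_eq_zero hAc hδ1 hsw hcent v, sub_zero]
    simpa using h1
  -- two-level gradient bounds: the pointwise defect at the local constant
  have hvv : 0 ≤ v ⬝ᵥ v := by simpa using dotProduct_self_star_nonneg v
  have hgrad : ∀ x, coordGradient φ x = fun i => fderiv ℝ (fderiv ℝ A) x (Pi.single i 1) v - v i := by
    intro x; funext i; exact fderiv_phi hA v x i
  have hgK : ∀ x ∈ K, coordGradient φ x ⬝ᵥ coordGradient φ x ≤ δK ^ 2 * (v ⬝ᵥ v) := by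
    intro x hx
    rw [hgrad x]
    exact defect_sq_le_of_abs_hess hA x v (abs_hess_sub_self_le_of_pinch (hloc x hx))
  have hg : ∀ x, coordGradient φ x ⬝ᵥ coordGradient φ x ≤ δ ^ 2 * (v ⬝ᵥ v) := by
    intro x
    rw [hgrad x]
    exact defect_sq_le_of_abs_hess hA x v (abs_hess_sub_self_le hA hsw x)
  -- localised Brascamp–Lieb
  have hbl := bl_raw_localised hA hδ1 hsw hK hδK1 (fun x hx w => (hloc x hx w).1) hφc1 hφb
    (cK := δK ^ 2 * (v ⬝ᵥ v)) (c := δ ^ 2 * (v ⬝ᵥ v)) (by positivity) (by positivity) hgK hg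
  rw [hφ0] at hbl
  have : (∫ x, φ x ^ 2 * exp (-A x)) * (∫ x, exp (-A x)) ≤
      ((v ⬝ᵥ v) * ((1 - δK)⁻¹ * δK ^ 2 * ((∫ x, exp (-A x)) - ∫ x in Kᶜ, exp (-A x)) +
        (1 - δ)⁻¹ * δ ^ 2 * ∫ x in Kᶜ, exp (-A x))) * ∫ x, exp (-A x) := by
    have e : (1 - δK)⁻¹ * (δK ^ 2 * (v ⬝ᵥ v)) * ((∫ x, exp (-A x)) - ∫ x in Kᶜ, exp (-A x)) +
        (1 - δ)⁻¹ * (δ ^ 2 * (v ⬝ᵥ v)) * ∫ x in Kᶜ, exp (-A x) =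
        (v ⬝ᵥ v) * ((1 - δK)⁻¹ * δK ^ 2 * ((∫ x, exp (-A x)) - ∫ x in Kᶜ, exp (-A x)) +
          (1 - δ)⁻¹ * δ ^ 2 * ∫ x in Kᶜ, exp (-A x)) := by ring
    rw [← e]
    nlinarith [hbl]
  exact le_of_mul_le_mul_right this hZ

end Summit.QuantumFields.YangMills.Theorems.SandwichVariancePinching

end
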